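import Literature.Geometry.Kaehler.ComplexTorusEquivariantEndomorphismAlgebraCommutantCyclicPowersIdempotents
import HarnessLib

/-!
# Which powers of a CM certificate are CM certificates: `P^r_{u^k}` is squarefree iff `d ↦ d/(d,k)` is injective on
# the eigenvalue orders `D(u)` and preserves `φ` there — `φ(d/(d,k)) = φ(d)` iff `(d,k) = 1`, or `(d,k) = 2` with `4 ∤ d`

Layer `Literature/Geometry/Kaehler`, namespace `Literature.Geometry.Kaehler.ComplexTorus` (§1 in
`Literature.Geometry.Kaehler.CyclotomicIdempotents`); lane `lit-hodgefound` (Track 2 foundations library), Layer A2,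
row «A2-26(fe)» (self-proposed 2026-08-28, prover seat `lit-hodgefound-p10`, generation 28, FILE 6).  Generations 26–27
made "`∃ u ∈ End_ℚ(X)` with `P^r_u` squarefree" the computable certificate for the CM type (ii) of a complex torus;
FILE 2 of this generation showed that every generator `u^k`, `(k, n) = 1`, of `⟨u⟩` passes when `u` does, and FILE 5
read the squarefree test of an arbitrary power on the multiplicities of `u`:
`P^r_{u^k}` squarefree iff `Σ_{d ∣ n, d/(d,k) = m} (φ(d)/φ(m)) h_d(u) ≤ 1` for every `m ∣ n`.  THIS FILE settles WHICH
POWERS of a certificate are certificates.  Unconditionally, `u^k` FAILS as soon as two eigenvalue orders `d ≠ d'` of `u`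
collide under `d ↦ d/(d,k)` (two isotypic components of `u` merge into one of `u^k`, which then carries `W_m` twice), or
one order `d ∈ D(u)` loses degree, `φ(d/(d,k)) < φ(d)` (the component `X^{e_d(u)}` alone carries `W_{d/(d,k)}` with
multiplicity `φ(d)/φ(d/(d,k)) ≥ 2`) — in particular whenever `d ∣ k` for some `d ∈ D(u)` with `d ≥ 3` (`u^k` has the
eigenvalue `1` at least `φ(d) ≥ 2` times).  When `P^r_u` IS squarefree (`h_d = 1` on `D(u)`), these are the only
obstructions: **`P^r_{u^k}` is squarefree iff `d ↦ d/(d,k)` is injective on `D(u)` and `φ(d/(d,k)) = φ(d)` for all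
`d ∈ D(u)`**, and the arithmetic of the last condition is elementary (Hardy–Wright Thms 60, 62):
**`φ(d/g) = φ(d)` for `g ∣ d` iff `(d/g, g) = 1` and `g ∈ {1, 2}`**, i.e. `g = (d,k) = 1`, or `(d,k) = 2` with
`d ≡ 2 (mod 4)` (e.g. `u = −ω` of order `6` on `E_ω`: `u² = ω²` still has `P^r = Φ_3` squarefree).  Instances: for the
order-`8` certificate `swapI` of `E_i × E_i` (`D = {8}`) EXACTLY THE ODD POWERS are certificates; for `(i, ω)` on
`E_i × E_ω` (`D = {4, 3}`) exactly the powers coprime to `12`.  CONSUMED BY NAME, nothing restated: FILE 5's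
`squarefree_charpoly_coe_pow_iff` / `totient_mul_cyclicMultiplicity_pow_eq_sum_eigenvalueOrders`, FILE 2's
`squarefree_charpoly_coe_pow_of_coprime`, generation 27's `squarefree_charpoly_coe_iff_forall_cyclicMultiplicity_le_one` /
`cyclicMultiplicity_eq_one_of_mem_eigenvalueOrders` / `cyclicMultiplicity_ne_zero_iff_mem_eigenvalueOrders`, generation 9's
`eigenvalueOrders`, FILE 1's `swapI` lemmas, FILE 3's `gaussOmega` lemmas, Mathlib's `Nat.totient_gcd_mul_totient_mul` /
`Nat.totient_eq_one_iff` / `Nat.totient_lt`.  Theorems only; NO definition, NO named fact (D-0026, net debt 0).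

## The print

* H. Lange, R. E. Rodríguez, *Decomposition of Jacobians by Prym Varieties*, LNM 2310 (2022), §2.9 Prop. 2.9.3
  (p0046: «`ρ_r = Σ_j h_j W_j`»), §6.1.1 Prop. 6.1.2 (p0153: the rational irreducible representations `W_d`, `d ∣ n`,
  of the cyclic group of order `n`, `deg W_d = φ(d)`).
* I. Dolgachev, Yu. G. Zarhin, *Endomorphisms of complex abelian varieties* (2024), §2.2 Thm. 2.18 (p0036: the
  squarefree / multiplicity-one criterion).
* G. H. Hardy, E. M. Wright, *An Introduction to the Theory of Numbers*, 6th ed. (2008), §5.5 Thm 60 (p0057: «`φ(n)`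
  is multiplicative»), Thm 62 (p0058: «If `m = Π p^c`, then `φ(m) = m Π (1 − 1/p)`»).
* R. A. Horn, C. R. Johnson, *Matrix Analysis*, 2nd ed. (2013), §1.4 Def. 1.4.4 (p0112).

## What is proved (`u ∈ End_ℚ(X)`, `uⁿ = 1`, `n, k > 0`, `D = eigenvalueOrders n u`, `h_d = cyclicMultiplicity Φ n u d`)

* §1 TOTIENT: **`totient_mul_eq_totient_iff`** (`φ(a g) = φ(a)` iff `(a, g) = 1 ∧ g ∈ {1, 2}`, `a, g > 0`),
  **`totient_div_gcd_eq_iff`** (`φ(d/(d,k)) = φ(d)` iff `(d/(d,k), (d,k)) = 1 ∧ (d,k) ∈ {1, 2}`),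
  `totient_div_gcd_eq_iff'` (iff `(d, k) = 1 ∨ ((d,k) = 2 ∧ 4 ∤ d)`), `two_le_totient_div_of_ne`
  (`φ(m) ≠ φ(d)`, `m ∣ d` ⟹ `φ(d)/φ(m) ≥ 2`).
* §2 NO-GOES (no hypothesis on `u`): **`not_squarefree_charpoly_coe_pow_of_ne`** (two orders `d ≠ d'` in `D` with
  `d/(d,k) = d'/(d',k)`), **`not_squarefree_charpoly_coe_pow_of_totient_ne`** (`d ∈ D`, `φ(d/(d,k)) ≠ φ(d)`),
  **`not_squarefree_charpoly_coe_pow_of_dvd`** (`d ∈ D`, `d ≥ 3`, `d ∣ k`), `not_squarefree_charpoly_coe_pow_orderOf`-type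
  corollary `not_squarefree_charpoly_coe_pow_self` (`k = n` when some `d ∈ D` has `d ≥ 3`).
* §3 THE CRITERION (`P^r_u` squarefree): `totient_mul_cyclicMultiplicity_pow_of_squarefree`
  (`φ(m) h_m(u^k) = Σ_{d ∈ D, d/(d,k) = m} φ(d)`), **`squarefree_charpoly_coe_pow_iff_of_squarefree`**
  (`P^r_{u^k}` squarefree iff `d ↦ d/(d,k)` injective on `D` ∧ `∀ d ∈ D, φ(d/(d,k)) = φ(d)`).
* §4 INSTANCES: **`squarefree_charpoly_swapI_pow_iff`** (`E_i × E_i`, `u = swapI`, `D = {8}`: `P^r_{u^k}` squarefree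
  iff `k` odd), **`squarefree_charpoly_gaussOmega_pow_iff`** (`E_i × E_ω`, `u = (i, ω)`, `D = {4, 3}`: iff `(k, 12) = 1`).

## References

* [LangeRodriguez2022] H. Lange, R. E. Rodríguez, *Decomposition of Jacobians by Prym Varieties*, LNM 2310 (2022),
  §2.9 Prop. 2.9.3, §6.1.1 Prop. 6.1.2.
* [DolgachevZarhin2024] I. Dolgachev, Yu. G. Zarhin, *Endomorphisms of Complex Abelian Varieties* (2024), §2.2 Thm. 2.18.
* [HardyWright2008] G. H. Hardy, E. M. Wright, *An Introduction to the Theory of Numbers*, 6th ed. (2008), §5.5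
  Thms 60, 62.
* [HornJohnson2013] R. A. Horn, C. R. Johnson, *Matrix Analysis*, 2nd ed. (2013), §1.4 Def. 1.4.4.
* [Lange2023AbelianVarietiesComplex] H. Lange, *Abelian Varieties over the Complex Numbers* (2023), §2.4.5 Exercise (10).
-/

noncomputable section

open Module Function Polynomial Finset
open scoped Matrix

namespace Literature.Geometry.Kaehler

/-! ### §1 `φ(d/g) = φ(d)` iff `(d/g, g) = 1` and `g ∈ {1, 2}` -/

namespace CyclotomicIdempotents

section Totient

/-- **`φ(a·g) = φ(a)` (`a, g > 0`) iff `(a, g) = 1` and `g ∈ {1, 2}`**: by `φ((a,g))·φ(ag) = φ(a)·φ(g)·(a,g)`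
(Hardy–Wright Thm 62) the equation forces `φ(g) = 1` and `φ((a,g)) = (a,g)`, i.e. `(a,g) = 1`; conversely
`φ(ag) = φ(a)φ(g) = φ(a)` (Thm 60). [cite: HardyWright2008, §5.5 Thm 60 (p0057), Thm 62 (p0058)] -/
theorem totient_mul_eq_totient_iff {a g : ℕ} (ha : 0 < a) (hg : 0 < g) :
    Nat.totient (a * g) = Nat.totient a ↔ a.Coprime g ∧ (g = 1 ∨ g = 2) := by
  constructor
  · intro h
    have key := Nat.totient_gcd_mul_totient_mul a g
    rw [h] at key
    have hφa : 0 < Nat.totient a := Nat.totient_pos.2 ha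
    have hc : 0 < a.gcd g := Nat.gcd_pos_of_pos_left _ ha
    have h1 : Nat.totient (a.gcd g) = Nat.totient g * a.gcd g := by
      have h' : Nat.totient (a.gcd g) * Nat.totient a = Nat.totient g * a.gcd g * Nat.totient a := by
        rw [key]; ring
      exact Nat.eq_of_mul_eq_mul_right hφa h'
    have hφg : 0 < Nat.totient g := Nat.totient_pos.2 hg
    have h2 : Nat.totient (a.gcd g) ≤ a.gcd g := Nat.totient_le _
    have h3 : Nat.totient g = 1 := by
      by_contra hne
      have h4 : 2 ≤ Nat.totient g := by omega
      have h5 : 2 * a.gcd g ≤ Nat.totient (a.gcd g) := by rw [h1]; exact Nat.mul_le_mul_right _ h4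
      omega
    rw [h3, one_mul] at h1
    have h4 : a.gcd g = 1 := by
      by_contra hne
      have h5 := Nat.totient_lt _ (by omega : 1 < a.gcd g)
      omega
    exact ⟨h4, Nat.totient_eq_one_iff.1 h3⟩
  · rintro ⟨hcop, h12⟩
    rw [Nat.totient_mul hcop, Nat.totient_eq_one_iff.2 h12, mul_one]

/-- **`φ(d/(d,k)) = φ(d)` (`d > 0`) iff `(d/(d,k), (d,k)) = 1` and `(d,k) ∈ {1, 2}`.**
[cite: HardyWright2008, §5.5 Thm 60 (p0057), Thm 62 (p0058)] -/
theorem totient_div_gcd_eq_iff {d : ℕ} (hd : 0 < d) (k : ℕ) :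
    Nat.totient (d / d.gcd k) = Nat.totient d ↔ (d / d.gcd k).Coprime (d.gcd k) ∧ (d.gcd k = 1 ∨ d.gcd k = 2) := by
  have hg : 0 < d.gcd k := Nat.gcd_pos_of_pos_left _ hd
  have ha : 0 < d / d.gcd k := Nat.div_pos (Nat.le_of_dvd hd (Nat.gcd_dvd_left d k)) hg
  have h := totient_mul_eq_totient_iff ha hg
  rw [Nat.div_mul_cancel (Nat.gcd_dvd_left d k)] at h
  rw [eq_comm]
  exact h

/-- Readable form: **`φ(d/(d,k)) = φ(d)` iff `(d, k) = 1`, or `(d, k) = 2` with `4 ∤ d`** (`d ≡ 2 (mod 4)`: e.g.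
`d = 6`, `k = 2`, `φ(3) = φ(6)` — the square of an automorphism of order `6` with `P^r = Φ_6` has `P^r = Φ_3`).
[cite: HardyWright2008, §5.5 Thm 60 (p0057), Thm 62 (p0058)] -/
theorem totient_div_gcd_eq_iff' {d : ℕ} (hd : 0 < d) (k : ℕ) :
    Nat.totient (d / d.gcd k) = Nat.totient d ↔ d.Coprime k ∨ (d.gcd k = 2 ∧ ¬ 4 ∣ d) := by
  rw [totient_div_gcd_eq_iff hd k]
  constructor
  · rintro ⟨hcop, h1 | h2⟩
    · exact Or.inl h1
    · refine Or.inr ⟨h2, fun h4 ↦ ?_⟩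
      rw [h2, Nat.coprime_two_right] at hcop
      obtain ⟨c, rfl⟩ := h4
      rw [show 4 * c = 2 * (2 * c) by ring, Nat.mul_div_cancel_left _ two_pos] at hcop
      exact (Nat.not_even_iff_odd.2 hcop) (even_two_mul c)
  · rintro (h1 | ⟨h2, h4⟩)
    · refine ⟨?_, Or.inl h1⟩
      rw [Nat.Coprime.gcd_eq_one h1]
      exact Nat.coprime_one_right _
    · refine ⟨?_, Or.inr h2⟩
      rw [h2, Nat.coprime_two_right]
      have h2d : 2 ∣ d := h2 ▸ Nat.gcd_dvd_left d k
      obtain ⟨c, rfl⟩ := h2d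
      rw [Nat.mul_div_cancel_left c two_pos]
      refine Nat.odd_iff.2 (Nat.two_dvd_ne_zero.1 fun ⟨e, he⟩ ↦ h4 ⟨e, by omega⟩)

/-- **`m ∣ d`, `φ(m) ≠ φ(d)` ⟹ `φ(d)/φ(m) ≥ 2`** (`φ(m) ∣ φ(d)`). [cite: HardyWright2008, §5.5 Thm 62 (p0058)] -/
theorem two_le_totient_div_of_ne {d m : ℕ} (hmd : m ∣ d) (hd : 0 < d) (hne : Nat.totient m ≠ Nat.totient d) :
    2 ≤ Nat.totient d / Nat.totient m := by
  obtain ⟨q, hq⟩ := Nat.totient_dvd_of_dvd hmd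
  have hφm : 0 < Nat.totient m := Nat.totient_pos.2 (Nat.pos_of_dvd_of_pos hmd hd)
  rw [hq, Nat.mul_div_cancel_left q hφm]
  rcases q with _ | _ | q
  · rw [mul_zero] at hq
    exact absurd hq (Nat.totient_pos.2 hd).ne'
  · rw [zero_add, mul_one] at hq
    exact absurd hq.symm hne
  · omega

end Totient

end CyclotomicIdempotents

/-! ### §2 No-goes: powers that are never certificates -/

namespace ComplexTorus

open CyclotomicIdempotents

universe u

variable {ι : Type u} [Fintype ι] [DecidableEq ι] {E : Type*} [NormedAddCommGroup E] [NormedSpace ℂ E]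
  {Φ : (ι → ℝ) ≃L[ℝ] E} {n : ℕ} {u : endAlgRat Φ}

section NoGo

/-- `(u^k)ⁿ = 1`. [folklore] -/
private theorem pow_pow_eq_one'' (hu : u ^ n = 1) (k : ℕ) : (u ^ k) ^ n = 1 := by
  rw [← pow_mul, mul_comm, pow_mul, hu, one_pow]

/-- `d/(d,k) ∣ n` for `d ∣ n`. [folklore] -/
private theorem div_gcd_mem_divisors'' {d : ℕ} (hd : d ∈ n.divisors) (k : ℕ) : d / d.gcd k ∈ n.divisors :=
  Nat.mem_divisors.2 ⟨(Nat.div_dvd_of_dvd (Nat.gcd_dvd_left d k)).trans (Nat.dvd_of_mem_divisors hd),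
    (Nat.mem_divisors.1 hd).2⟩

/-- The `d`-term of FILE 5's criterion is `≥ 1` for `d ∈ D(u)`. [folklore] -/
private theorem one_le_term (hn : 0 < n) (hu : u ^ n = 1) {k d m : ℕ} (hd : d ∈ eigenvalueOrders n u)
    (hm : d / d.gcd k = m) : 1 ≤ Nat.totient d / Nat.totient m * cyclicMultiplicity Φ n u d := by
  subst hm
  have hdn := (mem_eigenvalueOrders.1 hd).1
  have hd0 := Nat.pos_of_mem_divisors hdn
  have h1 : 1 ≤ Nat.totient d / Nat.totient (d / d.gcd k) :=
    Nat.div_pos (Nat.le_of_dvd (Nat.totient_pos.2 hd0)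
      (Nat.totient_dvd_of_dvd (Nat.div_dvd_of_dvd (Nat.gcd_dvd_left d k))))
      (Nat.totient_pos.2 (Nat.pos_of_mem_divisors (div_gcd_mem_divisors'' hdn k)))
  have h2 : 1 ≤ cyclicMultiplicity Φ n u d :=
    Nat.one_le_iff_ne_zero.2 ((cyclicMultiplicity_ne_zero_iff_mem_eigenvalueOrders Φ hn hu hdn).2 hd)
  exact Nat.mul_le_mul h1 h2

open scoped Classical in
/-- **Two eigenvalue orders `d ≠ d'` of `u` with `d/(d,k) = d'/(d',k)` ⟹ `P^r_{u^k}` is NOT squarefree**: the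
components `X^{e_d(u)}`, `X^{e_{d'}(u)}` merge into `X^{e_m(u^k)}`, which carries `W_m` at least twice.
[cite: LangeRodriguez2022, §2.9 Prop. 2.9.3 («`ρ_r = Σ_j h_j W_j`») and §6.1.1 Prop. 6.1.2, p0046, p0153] [cite: DolgachevZarhin2024, §2.2 Thm. 2.18, p0036] -/
theorem not_squarefree_charpoly_coe_pow_of_ne (hn : 0 < n) (hu : u ^ n = 1) {k : ℕ} (hk : 0 < k) {d d' : ℕ}
    (hd : d ∈ eigenvalueOrders n u) (hd' : d' ∈ eigenvalueOrders n u) (hne : d ≠ d')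
    (heq : d / d.gcd k = d' / d'.gcd k) : ¬ Squarefree ((u : Matrix ι ι ℚ) ^ k).charpoly := by
  rw [squarefree_charpoly_coe_pow_iff hn hu hk]
  intro h
  have hdn := (mem_eigenvalueOrders.1 hd).1
  have hdn' := (mem_eigenvalueOrders.1 hd').1
  have hm := h (d / d.gcd k) (div_gcd_mem_divisors'' hdn k)
  have hsub : ({d, d'} : Finset ℕ) ⊆ n.divisors.filter (fun x ↦ x / x.gcd k = d / d.gcd k) := by
    intro x hx
    rcases Finset.mem_insert.1 hx with rfl | hx
    · exact Finset.mem_filter.2 ⟨hdn, rfl⟩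
    · rw [Finset.mem_singleton.1 hx]
      exact Finset.mem_filter.2 ⟨hdn', heq.symm⟩
  have h2 := (Finset.sum_le_sum_of_subset hsub).trans hm
  rw [Finset.sum_pair hne] at h2
  have h1 := one_le_term hn hu hd (rfl : d / d.gcd k = d / d.gcd k)
  have h1' := one_le_term hn hu hd' heq.symm
  omega

open scoped Classical in
/-- **An eigenvalue order `d` of `u` with `φ(d/(d,k)) ≠ φ(d)` ⟹ `P^r_{u^k}` is NOT squarefree**: the component
`X^{e_d(u)}` alone carries `W_{d/(d,k)}` with multiplicity `φ(d)/φ(d/(d,k)) ≥ 2` under `u^k`.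
[cite: LangeRodriguez2022, §2.9 Prop. 2.9.3 and §6.1.1 Prop. 6.1.2, p0046, p0153] [cite: DolgachevZarhin2024, §2.2 Thm. 2.18, p0036] -/
theorem not_squarefree_charpoly_coe_pow_of_totient_ne (hn : 0 < n) (hu : u ^ n = 1) {k : ℕ} (hk : 0 < k) {d : ℕ}
    (hd : d ∈ eigenvalueOrders n u) (hφ : Nat.totient (d / d.gcd k) ≠ Nat.totient d) :
    ¬ Squarefree ((u : Matrix ι ι ℚ) ^ k).charpoly := by
  rw [squarefree_charpoly_coe_pow_iff hn hu hk]
  intro h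
  have hdn := (mem_eigenvalueOrders.1 hd).1
  have hm := h (d / d.gcd k) (div_gcd_mem_divisors'' hdn k)
  have hmem : d ∈ n.divisors.filter (fun x ↦ x / x.gcd k = d / d.gcd k) := Finset.mem_filter.2 ⟨hdn, rfl⟩
  have h1 := Finset.single_le_sum (f := fun x ↦ Nat.totient x / Nat.totient (d / d.gcd k) * cyclicMultiplicity Φ n u x)
    (fun _ _ ↦ Nat.zero_le _) hmem
  have h2 : 2 ≤ Nat.totient d / Nat.totient (d / d.gcd k) :=
    two_le_totient_div_of_ne (Nat.div_dvd_of_dvd (Nat.gcd_dvd_left d k)) (Nat.pos_of_mem_divisors hdn) hφ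
  have h3 : 1 ≤ cyclicMultiplicity Φ n u d :=
    Nat.one_le_iff_ne_zero.2 ((cyclicMultiplicity_ne_zero_iff_mem_eigenvalueOrders Φ hn hu hdn).2 hd)
  have h4 := Nat.mul_le_mul h2 h3
  have h5 := h1.trans hm
  omega

/-- **`d ∈ D(u)`, `d ≥ 3`, `d ∣ k` ⟹ `P^r_{u^k}` is NOT squarefree** (`u^k` has the eigenvalue `1` at least `φ(d) ≥ 2`
times). [cite: LangeRodriguez2022, §6.1.1 Prop. 6.1.2, p0153] [cite: HardyWright2008, §5.5 Thm 62 (p0058)] -/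
theorem not_squarefree_charpoly_coe_pow_of_dvd (hn : 0 < n) (hu : u ^ n = 1) {k : ℕ} (hk : 0 < k) {d : ℕ}
    (hd : d ∈ eigenvalueOrders n u) (h3 : 3 ≤ d) (hdk : d ∣ k) : ¬ Squarefree ((u : Matrix ι ι ℚ) ^ k).charpoly := by
  refine not_squarefree_charpoly_coe_pow_of_totient_ne hn hu hk hd ?_
  rw [Nat.gcd_eq_left hdk, Nat.div_self (by omega), Nat.totient_one]
  intro h1
  exact Nat.not_even_one (h1 ▸ Nat.totient_even (by omega : 2 < d))

/-- **`uⁿ = 1` itself is never a certificate once some `d ∈ D(u)` has `d ≥ 3`** (`rk Λ ≥ φ(d) ≥ 2` eigenvalues `1`).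
[cite: LangeRodriguez2022, §6.1.1 Prop. 6.1.2, p0153] -/
theorem not_squarefree_charpoly_coe_pow_self (hn : 0 < n) (hu : u ^ n = 1) {d : ℕ} (hd : d ∈ eigenvalueOrders n u)
    (h3 : 3 ≤ d) : ¬ Squarefree ((u : Matrix ι ι ℚ) ^ n).charpoly :=
  not_squarefree_charpoly_coe_pow_of_dvd hn hu hn hd h3 (Nat.dvd_of_mem_divisors (mem_eigenvalueOrders.1 hd).1)

end NoGo

/-! ### §3 The criterion for a certificate `u` (`P^r_u` squarefree) -/

section Criterion

open scoped Classical in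
/-- **`φ(m) h_m(u^k) = Σ_{d ∈ D(u), d/(d,k) = m} φ(d)`** when `P^r_u` is squarefree (`h_d = 1` on `D(u)`).
[cite: LangeRodriguez2022, §2.9 Prop. 2.9.3 (i), p0046; §6.1.1 Prop. 6.1.2, p0153] -/
theorem totient_mul_cyclicMultiplicity_pow_of_squarefree (hn : 0 < n) (hu : u ^ n = 1)
    (hsq : Squarefree (u : Matrix ι ι ℚ).charpoly) {k : ℕ} (hk : 0 < k) {m : ℕ} (hm : m ∈ n.divisors) :
    Nat.totient m * cyclicMultiplicity Φ n (u ^ k) m =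
      ∑ d ∈ (eigenvalueOrders n u).filter (fun d ↦ d / d.gcd k = m), Nat.totient d := by
  rw [totient_mul_cyclicMultiplicity_pow_eq_sum_eigenvalueOrders hn hu hk hm]
  exact Finset.sum_congr rfl fun d hd ↦ by
    rw [cyclicMultiplicity_eq_one_of_mem_eigenvalueOrders Φ hn hu hsq (Finset.mem_filter.1 hd).1, mul_one]

open scoped Classical in
/-- **WHICH POWERS OF A CERTIFICATE ARE CERTIFICATES: for `P^r_u` squarefree, `P^r_{u^k}` is squarefree iff
`d ↦ d/(d,k)` is injective on `D(u)` and `φ(d/(d,k)) = φ(d)` for every `d ∈ D(u)`** (then `ρ_r(u^k) = Σ_{d ∈ D} W_{d/(d,k)}`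
with distinct summands). [cite: LangeRodriguez2022, §2.9 Prop. 2.9.3 («`ρ_r = Σ_j h_j W_j`») and §6.1.1 Prop. 6.1.2, p0046, p0153]
[cite: DolgachevZarhin2024, §2.2 Thm. 2.18, p0036] -/
theorem squarefree_charpoly_coe_pow_iff_of_squarefree (hn : 0 < n) (hu : u ^ n = 1)
    (hsq : Squarefree (u : Matrix ι ι ℚ).charpoly) {k : ℕ} (hk : 0 < k) :
    Squarefree ((u : Matrix ι ι ℚ) ^ k).charpoly ↔
      (∀ d ∈ eigenvalueOrders n u, ∀ d' ∈ eigenvalueOrders n u, d / d.gcd k = d' / d'.gcd k → d = d') ∧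
        ∀ d ∈ eigenvalueOrders n u, Nat.totient (d / d.gcd k) = Nat.totient d := by
  constructor
  · intro h
    refine ⟨fun d hd d' hd' heq ↦ ?_, fun d hd ↦ ?_⟩
    · by_contra hne
      exact not_squarefree_charpoly_coe_pow_of_ne hn hu hk hd hd' hne heq h
    · by_contra hne
      exact not_squarefree_charpoly_coe_pow_of_totient_ne hn hu hk hd hne h
  · rintro ⟨hinj, hφ⟩
    rw [← SubmonoidClass.coe_pow,
      squarefree_charpoly_coe_iff_forall_cyclicMultiplicity_le_one Φ hn (pow_pow_eq_one'' hu k)]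
    intro m hm
    have hφm : 0 < Nat.totient m := Nat.totient_pos.2 (Nat.pos_of_mem_divisors hm)
    have key := totient_mul_cyclicMultiplicity_pow_of_squarefree hn hu hsq hk hm
    have hcard : ((eigenvalueOrders n u).filter (fun d ↦ d / d.gcd k = m)).card ≤ 1 :=
      Finset.card_le_one.2 fun a ha b hb ↦ hinj a (Finset.mem_filter.1 ha).1 b (Finset.mem_filter.1 hb).1
        ((Finset.mem_filter.1 ha).2.trans (Finset.mem_filter.1 hb).2.symm)
    have hsum : ∑ d ∈ (eigenvalueOrders n u).filter (fun d ↦ d / d.gcd k = m), Nat.totient d ≤ Nat.totient m := by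
      calc ∑ d ∈ (eigenvalueOrders n u).filter (fun d ↦ d / d.gcd k = m), Nat.totient d
          = ∑ d ∈ (eigenvalueOrders n u).filter (fun d ↦ d / d.gcd k = m), Nat.totient m :=
            Finset.sum_congr rfl fun d hd ↦ by
              rw [← (Finset.mem_filter.1 hd).2, hφ d (Finset.mem_filter.1 hd).1]
        _ = ((eigenvalueOrders n u).filter (fun d ↦ d / d.gcd k = m)).card * Nat.totient m := by
            rw [Finset.sum_const, smul_eq_mul]
        _ ≤ 1 * Nat.totient m := Nat.mul_le_mul_right _ hcard
        _ = Nat.totient m := one_mul _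
    have hle : Nat.totient m * cyclicMultiplicity Φ n (u ^ k) m ≤ Nat.totient m * 1 := by
      rw [key, mul_one]
      exact hsum
    exact Nat.le_of_mul_le_mul_left hle hφm

end Criterion

/-! ### §4 Instances: `swapI` on `E_i × E_i` (odd powers only), `(i, ω)` on `E_i × E_ω` (powers coprime to `12` only) -/

section Instances

/-- **`E_i × E_i`, `u = swapI` (`u⁸ = 1`, `D = {8}`, `P^r_u = Φ_8`): `P^r_{u^k}` is squarefree iff `k` is odd** — the even
powers `±(i, i)`, `−1`, `1` have `P^r = Φ_4², Φ_2⁴, Φ_1⁴`. [cite: LangeRodriguez2022, §6.1.1 Prop. 6.1.2, p0153]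
[cite: Lange2023AbelianVarietiesComplex, §2.4.5 Exercise (10), p0126] -/
theorem squarefree_charpoly_swapI_pow_iff {k : ℕ} (hk : 0 < k) :
    Squarefree ((swapI.map (Int.cast : ℤ → ℚ)) ^ k).charpoly ↔ Odd k := by
  have hu8 := swapEnd_pow_eight I_im_ne_zero
  have hD : (8 : ℕ) ∈ eigenvalueOrders 8 (⟨swapI.map (Int.cast : ℤ → ℚ), swapI_mem_endAlgRat I_im_ne_zero⟩ :
      endAlgRat (prodPeriod (ellipticPeriod I_im_ne_zero) (ellipticPeriod I_im_ne_zero))) := by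
    rw [eigenvalueOrders_swapI]
    exact Finset.mem_singleton_self 8
  constructor
  · intro h
    by_contra hodd
    obtain ⟨j, rfl⟩ := even_iff_two_dvd.1 (Nat.not_odd_iff_even.1 hodd)
    refine not_squarefree_charpoly_coe_pow_of_totient_ne (by norm_num) hu8 hk hD ?_ h
    have h1 : Nat.gcd 8 (2 * j) ∈ Nat.divisors 8 := Nat.mem_divisors.2 ⟨Nat.gcd_dvd_left _ _, by norm_num⟩
    have h2 : 2 ∣ Nat.gcd 8 (2 * j) := Nat.dvd_gcd (by norm_num) (dvd_mul_right 2 j)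
    rw [show Nat.divisors 8 = {1, 2, 4, 8} by decide] at h1
    simp only [Finset.mem_insert, Finset.mem_singleton] at h1
    rcases h1 with h1 | h1 | h1 | h1
    · rw [h1] at h2
      exact absurd h2 (by norm_num)
    all_goals rw [h1]; decide
  · intro hodd
    have h8 : k.Coprime 8 := by
      have h := (Nat.coprime_two_right.2 hodd).pow_right 3
      norm_num at h
      exact h
    have h := squarefree_charpoly_coe_pow_of_coprime (by norm_num) hu8 squarefree_charpoly_swapI hk h8
    rwa [SubmonoidClass.coe_pow] at h

/-- **`E_i × E_ω`, `u = (i, ω)` (`u¹² = 1`, `D = {4, 3}`, `P^r_u = Φ_4 Φ_3`): `P^r_{u^k}` is squarefree iff `(k, 12) = 1`**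
— `2 ∣ k` degrades `W_4` (`φ(4/(4,k)) = 1 < 2`), `3 ∣ k` kills `W_3` (`ω^k = 1` twice).
[cite: LangeRodriguez2022, §6.1.1 Prop. 6.1.2, p0153] [cite: Lange2023AbelianVarietiesComplex, §2.4.5 Exercise (10), p0126] -/
theorem squarefree_charpoly_gaussOmega_pow_iff {k : ℕ} (hk : 0 < k) :
    Squarefree ((Matrix.fromBlocks gaussJ 0 0 (rotOmega.map (Int.cast : ℤ → ℚ))) ^ k).charpoly ↔ k.Coprime 12 := by
  have hu12 := gaussOmegaEnd_pow_twelve I_im_ne_zero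
  have hD := eigenvalueOrders_surfaceAut I_im_ne_zero
  constructor
  · intro h
    by_contra hcop
    have h23 : 2 ∣ k ∨ 3 ∣ k := by
      by_contra hh
      rw [not_or] at hh
      apply hcop
      have h2 : k.Coprime 2 := ((Nat.Prime.coprime_iff_not_dvd Nat.prime_two).2 hh.1).symm
      have h3 : k.Coprime 3 := ((Nat.Prime.coprime_iff_not_dvd Nat.prime_three).2 hh.2).symm
      have h' := (h2.pow_right 2).mul_right h3
      norm_num at h'
      exact h'
    rcases h23 with h2 | h3
    · refine not_squarefree_charpoly_coe_pow_of_totient_ne (by norm_num) hu12 hk (d := 4)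
        (by rw [hD]; exact Finset.mem_insert_self 4 _) ?_ h
      obtain ⟨j, rfl⟩ := h2
      have h1 : Nat.gcd 4 (2 * j) ∈ Nat.divisors 4 := Nat.mem_divisors.2 ⟨Nat.gcd_dvd_left _ _, by norm_num⟩
      have hdvd : 2 ∣ Nat.gcd 4 (2 * j) := Nat.dvd_gcd (by norm_num) (dvd_mul_right 2 j)
      rw [show Nat.divisors 4 = {1, 2, 4} by decide] at h1
      simp only [Finset.mem_insert, Finset.mem_singleton] at h1
      rcases h1 with h1 | h1 | h1
      · rw [h1] at hdvd
        exact absurd hdvd (by norm_num)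
      all_goals rw [h1]; decide
    · exact not_squarefree_charpoly_coe_pow_of_dvd (by norm_num) hu12 hk (d := 3)
        (by rw [hD]; exact Finset.mem_insert_of_mem (Finset.mem_singleton_self 3)) le_rfl h3 h
  · intro hk'
    have h := squarefree_charpoly_coe_pow_of_coprime (by norm_num) hu12 squarefree_charpoly_gaussOmega hk hk'
    rwa [SubmonoidClass.coe_pow] at h

end Instances

end ComplexTorus

end Literature.Geometry.Kaehler
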